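import Summits.AtomisticToContinuum.Crystallization.Theorems.FrustratedLawDichotomyTailFloorRangeCut

/-!
# FrustratedLawDichotomy · the DISCHARGING KERNEL beneath lens-5's finite-range residuals (column 27623, energetic feed)

State of record (critic rows 480/484/485, TREE v2.55): the energetic feed of crux `AperiodicFrustratedLawGap` (item 27623) is
`FDG ⟺ E′ ∧ T′` (`…RangeCut`, lens-5 g33) with `T′ ⟸ TF ∧ UP ∧ T′_R` (TF PROVED at every `R`, `…TailFloorRangeCut`; UP a tree number),
declared residual `T′_9^tf = FiniteRangeTopologicalPricing (1/20) (1/8) 9 (11/5000) (−0.7175) κ_T C_T`, audit twins `T′_7`, `FRG_R`.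
All of these are GLOBAL linear inequalities over a whole finite cluster, `Σ_i level_i ≤ U_R(y) − A·Σ_i m_i`, whose right-hand side is
itself a sum of ONE-SITE quantities (`½·Σ_j truncLJ R (r_ij) − A·m_i`).  NODE-g33 §6 / census TAG 181 want to attack them by «interval LP
per radius-`R` motif», i.e. SITEWISE — but sitewise pricing is false as such (icosahedral centres sit below `e⋆`; collective pricing is the
TetrahedralFrustration barrier).  The classical format that is both sitewise and collective is DISCHARGING: price every site AFTER a
redistribution by pair transfers.  This file lands that format, DEF-FREE, with every kernel proved:

* §1 the abstract kernel on any finite index type: `sum_netFlow_eq_zero` (for ARBITRARY transfers `τ i j` the net inflows sum to `0`),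
  `sum_le_sum_of_transfers` (sitewise-after-transfers ⟹ global) and the converse `exists_transfers_of_sum_le` (the EQUALISING antisymmetric
  transfer) — so «∃ transfers, sitewise» is EXACTLY EQUIVALENT to the global inequality: no strength is lost, and all the content of a
  certificate is in RESTRICTING the transfers (finite range, a rule reading only the local motif) — the INSTRUMENTABLE leaf;
  `interactionEnergy_eq_sum_shares`: the same freedom written as ASYMMETRIC BOND SHARES `w i j + w j i = 1`;
* §2 the one-site bookkeeping: `2·U_V = Σ_i Σ_j V(r_ij)` for `truncLJ R` / `lennardJones`, `goodCount η y = Σ_i 𝟙[GoodAt η y i]`;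
* §3 ★ the residuals of record in sitewise-after-transfers form, both directions:
  `finiteRangeFrustrationGap_iff_sitewise` (FRG_R), `finiteRangeTopologicalPricing_iff_sitewise` (T′_R),
  and the bond-share variants `…_of_shares`;
* §4 the missing twin of lens-5's Cut B on the ELASTIC side: `elasticPricing_of_rangeCut'` / `_of_rangeCut` / `_of_rangeCut_tf`
  (`E′ ⟸ TF ∧ UP ∧ E′_R`, the finite-range elastic inequality written inline), and its sitewise form;
* §5 the crux BY NAME from sitewise certificates: `aperiodicFrustratedLawGap_of_sitewise_frg` (unsplit, any `R > 0`, `A = A_R`),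
  `aperiodicFrustratedLawGap_of_sitewise_split` (E′ ∧ sitewise T′_R), `aperiodicFrustratedLawGap_of_rangeCut_both_tf` (both strain currencies
  at finite range: `MuEquilibriumDoor ∧ UP ∧ E′_R ∧ T′_R ⟹ crux`).

Nothing here is new analysis: [folklore] bookkeeping (discharging / local-density redistribution is the format of Hales-type local-to-global
arguments).  What it buys: the declared residual `T′_9^tf` (and `FRG_9`, `E′_R`) may now be fed to the tree ONE MOTIF AT A TIME — a transfer
RULE of range `L` plus a per-motif inequality on radius-`max(R, 1.4·R) + L` motifs — without touching any kernel above.  DEF-FREE; 0 sorry.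
Prover hand 2, gen 12 (decomp-a2c), `--supports stmt-AtomisticToContinuum-27623`.
-/

noncomputable section

namespace Summit.AtomisticToContinuum.Crystallization.Theorems.FrustratedLawDichotomyLocalPricing

open scoped BigOperators Classical
open Literature.MathematicalPhysics.StatisticalMechanics (interactionEnergy lennardJones lennardJones_zero
  two_mul_interactionEnergy_eq_sum_sum)
open Summit.AtomisticToContinuum.Crystallization.Theorems.ChargedEnergyGapNegative (E3 eStar eStar_le)
open Summit.AtomisticToContinuum.Crystallization.Theorems.FrustratedLawDichotomyRangeCut
open Summit.AtomisticToContinuum.Crystallization.Theorems.FrustratedLawDichotomyTailFloor (tailFloor_holds)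

/-! ## §1. The discharging kernel on a finite index type -/

/-- **Net flow sums to zero**: for ARBITRARY pair transfers `τ i j` («site `i` sends `τ i j` to site `j`») the net inflows
`Σ_j τ j i − Σ_j τ i j` sum to zero over all sites. [folklore] -/
theorem sum_netFlow_eq_zero {ι : Type*} [Fintype ι] (τ : ι → ι → ℝ) :
    ∑ i, (∑ j, τ j i - ∑ j, τ i j) = 0 := by
  have h : ∑ i, ∑ j, τ j i = ∑ i, ∑ j, τ i j := Finset.sum_comm
  rw [Finset.sum_sub_distrib, h, sub_self]

/-- **DISCHARGING, local ⟹ global**: if after SOME redistribution by pair transfers every site meets its target,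
`ℓ i ≤ h i + (inflow_i − outflow_i)`, then `Σ ℓ ≤ Σ h`. [folklore] -/
theorem sum_le_sum_of_transfers {ι : Type*} [Fintype ι] {h ℓ : ι → ℝ} (τ : ι → ι → ℝ)
    (hloc : ∀ i, ℓ i ≤ h i + (∑ j, τ j i - ∑ j, τ i j)) : ∑ i, ℓ i ≤ ∑ i, h i :=
  calc ∑ i, ℓ i ≤ ∑ i, (h i + (∑ j, τ j i - ∑ j, τ i j)) := Finset.sum_le_sum fun i _ => hloc i
    _ = ∑ i, h i := by rw [Finset.sum_add_distrib, sum_netFlow_eq_zero, add_zero]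

/-- **EQUALISING TRANSFER, global ⟹ local**: conversely, if `Σ ℓ ≤ Σ h` then the ANTISYMMETRIC transfers
`τ i j = ((h i − ℓ i) − (h j − ℓ j)) / (2·#ι)` make every site meet its target (each site ends exactly at `ℓ i + slack/#ι`).
Hence «∃ transfers, sitewise» is EQUIVALENT to the global inequality — a certificate's content is the RESTRICTION of the transfers. [folklore] -/
theorem exists_transfers_of_sum_le {ι : Type*} [Fintype ι] {h ℓ : ι → ℝ} (H : ∑ i, ℓ i ≤ ∑ i, h i) :
    ∃ τ : ι → ι → ℝ, (∀ i j, τ j i = -τ i j) ∧ ∀ i, ℓ i ≤ h i + (∑ j, τ j i - ∑ j, τ i j) := by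
  refine ⟨fun i j => ((h i - ℓ i) - (h j - ℓ j)) / (2 * Fintype.card ι), fun i j => by ring, fun i => ?_⟩
  have hn : (0 : ℝ) < Fintype.card ι := Nat.cast_pos.mpr (Fintype.card_pos_iff.mpr ⟨i⟩)
  have hS : 0 ≤ ∑ j, (h j - ℓ j) := by rw [Finset.sum_sub_distrib]; linarith
  have key : (∑ j, ((h j - ℓ j) - (h i - ℓ i)) / (2 * (Fintype.card ι : ℝ))
      - ∑ j, ((h i - ℓ i) - (h j - ℓ j)) / (2 * (Fintype.card ι : ℝ)))
      = (∑ j, (h j - ℓ j)) / (Fintype.card ι : ℝ) - (h i - ℓ i) := by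
    have e1 : (∑ j, ((h j - ℓ j) - (h i - ℓ i)) / (2 * (Fintype.card ι : ℝ))
        - ∑ j, ((h i - ℓ i) - (h j - ℓ j)) / (2 * (Fintype.card ι : ℝ)))
        = ∑ j, ((h j - ℓ j) - (h i - ℓ i)) / (Fintype.card ι : ℝ) := by
      rw [← Finset.sum_sub_distrib]
      refine Finset.sum_congr rfl fun j _ => ?_
      field_simp
      ring
    rw [e1, ← Finset.sum_div, Finset.sum_sub_distrib, Finset.sum_const, Finset.card_univ, nsmul_eq_mul, sub_div,
      mul_div_cancel_left₀ _ hn.ne']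
  rw [key]
  have := div_nonneg hS hn.le
  linarith

/-- The local ⟺ global dictionary in one line. [folklore] -/
theorem sum_le_sum_iff_exists_transfers {ι : Type*} [Fintype ι] {h ℓ : ι → ℝ} :
    ∑ i, ℓ i ≤ ∑ i, h i ↔ ∃ τ : ι → ι → ℝ, (∀ i j, τ j i = -τ i j) ∧ ∀ i, ℓ i ≤ h i + (∑ j, τ j i - ∑ j, τ i j) :=
  ⟨exists_transfers_of_sum_le, fun ⟨τ, _, hτ⟩ => sum_le_sum_of_transfers τ hτ⟩

/-- **ASYMMETRIC BOND SHARES**: for a potential with `V 0 = 0` and any shares `w i j + w j i = 1` on the bonds `i ≠ j` (diagonal shares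
arbitrary), `U_V(y) = Σ_i Σ_j w i j · V(r_ij)` — each bond's energy may be booked at either end in any proportion. [folklore] -/
theorem interactionEnergy_eq_sum_shares {N : ℕ} (V : ℝ → ℝ) (hV : V 0 = 0) (y : Fin N → E3) (w : Fin N → Fin N → ℝ)
    (hw : ∀ i j, i ≠ j → w i j + w j i = 1) :
    interactionEnergy V y = ∑ i, ∑ j, w i j * V (dist (y i) (y j)) := by
  have h2 := two_mul_interactionEnergy_eq_sum_sum V hV y
  have hsym : ∑ i, ∑ j, w i j * V (dist (y i) (y j)) = ∑ i, ∑ j, w j i * V (dist (y i) (y j)) := by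
    rw [Finset.sum_comm]
    refine Finset.sum_congr rfl fun i _ => Finset.sum_congr rfl fun j _ => ?_
    rw [dist_comm]
  have hadd : ∑ i, ∑ j, w i j * V (dist (y i) (y j)) + ∑ i, ∑ j, w j i * V (dist (y i) (y j))
      = ∑ i, ∑ j, V (dist (y i) (y j)) := by
    rw [← Finset.sum_add_distrib]
    refine Finset.sum_congr rfl fun i _ => ?_
    rw [← Finset.sum_add_distrib]
    refine Finset.sum_congr rfl fun j _ => ?_
    by_cases hij : i = j
    · subst hij
      simp [hV]
    · rw [← add_mul, hw i j hij, one_mul]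
  linarith [hsym, hadd, h2]

/-! ## §2. One-site bookkeeping -/

/-- `truncLJ R 0 = 0` (tree convention `lennardJones 0 = 0`). [folklore] -/
theorem truncLJ_zero (R : ℝ) : truncLJ R 0 = 0 := by
  unfold truncLJ
  split_ifs <;> simp [lennardJones_zero]

/-- `2·U_R(y) = Σ_i Σ_j truncLJ R (r_ij)` (diagonal included, it vanishes). [folklore] -/
theorem two_mul_interactionEnergy_truncLJ (R : ℝ) {N : ℕ} (y : Fin N → E3) :
    2 * interactionEnergy (truncLJ R) y = ∑ i, ∑ j, truncLJ R (dist (y i) (y j)) :=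
  two_mul_interactionEnergy_eq_sum_sum (truncLJ R) (truncLJ_zero R) y

/-- `2·U(y) = Σ_i Σ_j V_LJ(r_ij)`. [folklore] -/
theorem two_mul_interactionEnergy_lennardJones {N : ℕ} (y : Fin N → E3) :
    2 * interactionEnergy lennardJones y = ∑ i, ∑ j, lennardJones (dist (y i) (y j)) :=
  two_mul_interactionEnergy_eq_sum_sum lennardJones lennardJones_zero y

/-- `goodCount η y = Σ_i 𝟙[GoodAt η y i]` (as reals). [folklore] -/
theorem goodCount_eq_sum (η : ℝ) {N : ℕ} (y : Fin N → E3) :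
    (goodCount η y : ℝ) = ∑ i, (if GoodAt η y i then (1 : ℝ) else 0) := by
  rw [Finset.sum_boole, goodCount, Nat.card_eq_fintype_card, Fintype.card_subtype]

/-! ## §3. The finite-range residuals of record, sitewise after transfers -/

/-- **FRG_R, local ⟹ global**: if for every `7/10`-separated cluster SOME transfers make every site meet the level
`e₁ − C·𝟙[tightly good]` with its half truncated energy minus the density allowance, `½Σ_j truncLJ R (r_ij) − A·m_i + netflow_i`,
then `FiniteRangeFrustrationGap R A e₁ C`. [folklore] -/
theorem finiteRangeFrustrationGap_of_sitewise {R A e₁ C : ℝ}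
    (h : ∀ (N : ℕ) (y : Fin N → E3), Function.Injective y → Sep y →
      ∃ τ : Fin N → Fin N → ℝ, ∀ i : Fin N,
        e₁ - C * (if GoodAt (1 / 20) y i then (1 : ℝ) else 0) ≤
          (∑ j, truncLJ R (dist (y i) (y j))) / 2 - A * densityProxy y i + (∑ j, τ j i - ∑ j, τ i j)) :
    FiniteRangeFrustrationGap R A e₁ C := by
  intro N y hy hsep
  obtain ⟨τ, hτ⟩ := h N y hy hsep
  have hs := sum_le_sum_of_transfers τ hτ
  simp only [Finset.sum_sub_distrib, Finset.sum_const, Finset.card_univ, Fintype.card_fin, nsmul_eq_mul, ← Finset.mul_sum,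
    ← Finset.sum_div] at hs
  rw [← goodCount_eq_sum, ← two_mul_interactionEnergy_truncLJ] at hs
  linarith

/-- **FRG_R, global ⟹ local** (equalising transfer): no strength is lost in the sitewise form. [folklore] -/
theorem sitewise_of_finiteRangeFrustrationGap {R A e₁ C : ℝ} (hF : FiniteRangeFrustrationGap R A e₁ C)
    (N : ℕ) (y : Fin N → E3) (hy : Function.Injective y) (hsep : Sep y) :
    ∃ τ : Fin N → Fin N → ℝ, (∀ i j, τ j i = -τ i j) ∧ ∀ i : Fin N,
        e₁ - C * (if GoodAt (1 / 20) y i then (1 : ℝ) else 0) ≤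
          (∑ j, truncLJ R (dist (y i) (y j))) / 2 - A * densityProxy y i + (∑ j, τ j i - ∑ j, τ i j) := by
  apply exists_transfers_of_sum_le
  have h1 := hF N y hy hsep
  simp only [Finset.sum_sub_distrib, Finset.sum_const, Finset.card_univ, Fintype.card_fin, nsmul_eq_mul, ← Finset.mul_sum,
    ← Finset.sum_div]
  rw [← goodCount_eq_sum, ← two_mul_interactionEnergy_truncLJ]
  linarith

/-- ★ **FRG_R ⟺ SITEWISE AFTER (antisymmetric) TRANSFERS.** [folklore] -/
theorem finiteRangeFrustrationGap_iff_sitewise {R A e₁ C : ℝ} :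
    FiniteRangeFrustrationGap R A e₁ C ↔
      ∀ (N : ℕ) (y : Fin N → E3), Function.Injective y → Sep y →
        ∃ τ : Fin N → Fin N → ℝ, (∀ i j, τ j i = -τ i j) ∧ ∀ i : Fin N,
          e₁ - C * (if GoodAt (1 / 20) y i then (1 : ℝ) else 0) ≤
            (∑ j, truncLJ R (dist (y i) (y j))) / 2 - A * densityProxy y i + (∑ j, τ j i - ∑ j, τ i j) :=
  ⟨sitewise_of_finiteRangeFrustrationGap, fun h =>
    finiteRangeFrustrationGap_of_sitewise fun N y hy hsep => by
      obtain ⟨τ, -, hτ⟩ := h N y hy hsep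
      exact ⟨τ, hτ⟩⟩

/-- **FRG_R from ASYMMETRIC BOND SHARES** (the same freedom without explicit transfers): if every cluster admits shares
`w i j + w j i = 1` under which every site meets its level with `Σ_j w i j · truncLJ R (r_ij) − A·m_i`, then FRG_R. [folklore] -/
theorem finiteRangeFrustrationGap_of_shares {R A e₁ C : ℝ}
    (h : ∀ (N : ℕ) (y : Fin N → E3), Function.Injective y → Sep y →
      ∃ w : Fin N → Fin N → ℝ, (∀ i j, i ≠ j → w i j + w j i = 1) ∧ ∀ i : Fin N,
        e₁ - C * (if GoodAt (1 / 20) y i then (1 : ℝ) else 0) ≤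
          (∑ j, w i j * truncLJ R (dist (y i) (y j))) - A * densityProxy y i) :
    FiniteRangeFrustrationGap R A e₁ C := by
  intro N y hy hsep
  obtain ⟨w, hw, hi⟩ := h N y hy hsep
  have hs : ∑ i, (e₁ - C * (if GoodAt (1 / 20) y i then (1 : ℝ) else 0)) ≤
      ∑ i, ((∑ j, w i j * truncLJ R (dist (y i) (y j))) - A * densityProxy y i) := Finset.sum_le_sum fun i _ => hi i
  simp only [Finset.sum_sub_distrib, Finset.sum_const, Finset.card_univ, Fintype.card_fin, nsmul_eq_mul, ← Finset.mul_sum] at hs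
  rw [← goodCount_eq_sum, ← interactionEnergy_eq_sum_shares (truncLJ R) (truncLJ_zero R) y w hw] at hs
  linarith

/-- **T′_R, local ⟹ global**: sitewise level `eUp + κ_T·𝟙[loosely bad] − C_T·𝟙[tightly good]` after transfers
⟹ `FiniteRangeTopologicalPricing η₀ η₁ R A eUp κ_T C_T`. [folklore] -/
theorem finiteRangeTopologicalPricing_of_sitewise {η₀ η₁ R A eUp κT CT : ℝ}
    (h : ∀ (N : ℕ) (y : Fin N → E3), Function.Injective y → Sep y →
      ∃ τ : Fin N → Fin N → ℝ, ∀ i : Fin N,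
        eUp + κT * (1 - (if GoodAt η₁ y i then (1 : ℝ) else 0)) - CT * (if GoodAt η₀ y i then (1 : ℝ) else 0) ≤
          (∑ j, truncLJ R (dist (y i) (y j))) / 2 - A * densityProxy y i + (∑ j, τ j i - ∑ j, τ i j)) :
    FiniteRangeTopologicalPricing η₀ η₁ R A eUp κT CT := by
  intro N y hy hsep
  obtain ⟨τ, hτ⟩ := h N y hy hsep
  have hs := sum_le_sum_of_transfers τ hτ
  simp only [Finset.sum_sub_distrib, Finset.sum_add_distrib, Finset.sum_const, Finset.card_univ, Fintype.card_fin, nsmul_eq_mul,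
    ← Finset.mul_sum, ← Finset.sum_div] at hs
  rw [← goodCount_eq_sum, ← goodCount_eq_sum, ← two_mul_interactionEnergy_truncLJ] at hs
  linarith

/-- **T′_R, global ⟹ local** (equalising transfer). [folklore] -/
theorem sitewise_of_finiteRangeTopologicalPricing {η₀ η₁ R A eUp κT CT : ℝ}
    (hF : FiniteRangeTopologicalPricing η₀ η₁ R A eUp κT CT)
    (N : ℕ) (y : Fin N → E3) (hy : Function.Injective y) (hsep : Sep y) :
    ∃ τ : Fin N → Fin N → ℝ, (∀ i j, τ j i = -τ i j) ∧ ∀ i : Fin N,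
        eUp + κT * (1 - (if GoodAt η₁ y i then (1 : ℝ) else 0)) - CT * (if GoodAt η₀ y i then (1 : ℝ) else 0) ≤
          (∑ j, truncLJ R (dist (y i) (y j))) / 2 - A * densityProxy y i + (∑ j, τ j i - ∑ j, τ i j) := by
  apply exists_transfers_of_sum_le
  have h1 := hF N y hy hsep
  simp only [Finset.sum_sub_distrib, Finset.sum_add_distrib, Finset.sum_const, Finset.card_univ, Fintype.card_fin, nsmul_eq_mul,
    ← Finset.mul_sum, ← Finset.sum_div]
  rw [← goodCount_eq_sum, ← goodCount_eq_sum, ← two_mul_interactionEnergy_truncLJ]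
  linarith

/-- ★ **T′_R ⟺ SITEWISE AFTER (antisymmetric) TRANSFERS** — the declared residual `T′_9^tf` in motif-ready form. [folklore] -/
theorem finiteRangeTopologicalPricing_iff_sitewise {η₀ η₁ R A eUp κT CT : ℝ} :
    FiniteRangeTopologicalPricing η₀ η₁ R A eUp κT CT ↔
      ∀ (N : ℕ) (y : Fin N → E3), Function.Injective y → Sep y →
        ∃ τ : Fin N → Fin N → ℝ, (∀ i j, τ j i = -τ i j) ∧ ∀ i : Fin N,
          eUp + κT * (1 - (if GoodAt η₁ y i then (1 : ℝ) else 0)) - CT * (if GoodAt η₀ y i then (1 : ℝ) else 0) ≤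
            (∑ j, truncLJ R (dist (y i) (y j))) / 2 - A * densityProxy y i + (∑ j, τ j i - ∑ j, τ i j) :=
  ⟨sitewise_of_finiteRangeTopologicalPricing, fun h =>
    finiteRangeTopologicalPricing_of_sitewise fun N y hy hsep => by
      obtain ⟨τ, -, hτ⟩ := h N y hy hsep
      exact ⟨τ, hτ⟩⟩

/-- **T′_R from ASYMMETRIC BOND SHARES**. [folklore] -/
theorem finiteRangeTopologicalPricing_of_shares {η₀ η₁ R A eUp κT CT : ℝ}
    (h : ∀ (N : ℕ) (y : Fin N → E3), Function.Injective y → Sep y →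
      ∃ w : Fin N → Fin N → ℝ, (∀ i j, i ≠ j → w i j + w j i = 1) ∧ ∀ i : Fin N,
        eUp + κT * (1 - (if GoodAt η₁ y i then (1 : ℝ) else 0)) - CT * (if GoodAt η₀ y i then (1 : ℝ) else 0) ≤
          (∑ j, w i j * truncLJ R (dist (y i) (y j))) - A * densityProxy y i) :
    FiniteRangeTopologicalPricing η₀ η₁ R A eUp κT CT := by
  intro N y hy hsep
  obtain ⟨w, hw, hi⟩ := h N y hy hsep
  have hs : ∑ i, (eUp + κT * (1 - (if GoodAt η₁ y i then (1 : ℝ) else 0)) - CT * (if GoodAt η₀ y i then (1 : ℝ) else 0)) ≤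
      ∑ i, ((∑ j, w i j * truncLJ R (dist (y i) (y j))) - A * densityProxy y i) := Finset.sum_le_sum fun i _ => hi i
  simp only [Finset.sum_sub_distrib, Finset.sum_add_distrib, Finset.sum_const, Finset.card_univ, Fintype.card_fin, nsmul_eq_mul,
    ← Finset.mul_sum] at hs
  rw [← goodCount_eq_sum, ← goodCount_eq_sum, ← interactionEnergy_eq_sum_shares (truncLJ R) (truncLJ_zero R) y w hw] at hs
  linarith

/-! ## §4. The range cut on the ELASTIC side (twin of lens-5's Cut B): `E′ ⟸ TF ∧ UP ∧ E′_R` -/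

/-- **KERNEL of the range cut beneath E′, `e⋆`-form**: `TF(R,A) ∧ (e⋆ ≤ eUp) ∧ E′_R ⟹ E′` (same `κ_E, C_E, D_E`), where `E′_R` is the
finite-range elastic inequality «`eUp·N + κ_E·(ℓ − g) − C_E·g − D_E·(N − ℓ) ≤ U_R − A·Σ m_i`» (written inline; `ℓ = goodCount η₁`,
`g = goodCount η₀`). [folklore] -/
theorem elasticPricing_of_rangeCut' {η₀ η₁ R A eUp κE CE DE : ℝ} (hT : TailFloor R A) (hst : eStar ≤ eUp) (hκ : 0 < κE)
    (hF : ∀ (N : ℕ) (y : Fin N → E3), Function.Injective y → Sep y →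
      eUp * N + κE * ((goodCount η₁ y : ℝ) - goodCount η₀ y) - CE * goodCount η₀ y - DE * ((N : ℝ) - goodCount η₁ y) ≤
        interactionEnergy (truncLJ R) y - A * ∑ i, densityProxy y i) :
    ElasticPricing η₀ η₁ := by
  refine ⟨κE, hκ, CE, DE, fun N y hy hsep => ?_⟩
  have h1 := hT N y hy hsep
  have h2 := hF N y hy hsep
  have hN : (N : ℝ) * eStar ≤ N * eUp := mul_le_mul_of_nonneg_left hst (Nat.cast_nonneg N)
  rw [interactionEnergy_split R y]
  linarith

/-- **KERNEL of the range cut beneath E′**: `TF(R,A) ∧ UP(eUp) ∧ E′_R ⟹ E′`. [folklore] -/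
theorem elasticPricing_of_rangeCut {η₀ η₁ R A eUp κE CE DE : ℝ} (hT : TailFloor R A) (hU : PeriodicEnergyCeiling eUp) (hκ : 0 < κE)
    (hF : ∀ (N : ℕ) (y : Fin N → E3), Function.Injective y → Sep y →
      eUp * N + κE * ((goodCount η₁ y : ℝ) - goodCount η₀ y) - CE * goodCount η₀ y - DE * ((N : ℝ) - goodCount η₁ y) ≤
        interactionEnergy (truncLJ R) y - A * ∑ i, densityProxy y i) :
    ElasticPricing η₀ η₁ :=
  elasticPricing_of_rangeCut' hT (eStar_le_of_periodicEnergyCeiling hU) hκ hF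

/-- **`E′ ⟸ UP ∧ E′_R` with the tail floor DISCHARGED** (`A = A_R = (4/3)(1 + 1/(2R))³/R³`, any `R > 0`). [folklore chaining] -/
theorem elasticPricing_of_rangeCut_tf {η₀ η₁ R eUp κE CE DE : ℝ} (hR : 0 < R) (hU : PeriodicEnergyCeiling eUp) (hκ : 0 < κE)
    (hF : ∀ (N : ℕ) (y : Fin N → E3), Function.Injective y → Sep y →
      eUp * N + κE * ((goodCount η₁ y : ℝ) - goodCount η₀ y) - CE * goodCount η₀ y - DE * ((N : ℝ) - goodCount η₁ y) ≤
        interactionEnergy (truncLJ R) y - (4 / 3 * (1 + 1 / (2 * R)) ^ 3 / R ^ 3) * ∑ i, densityProxy y i) :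
    ElasticPricing η₀ η₁ :=
  elasticPricing_of_rangeCut (tailFloor_holds hR) hU hκ hF

/-- **E′_R, local ⟹ global**: sitewise level `eUp + κ_E·𝟙[strained] − C_E·𝟙[tightly good] − D_E·𝟙[loosely bad]` after transfers
(`strained = loosely good ∧ ¬ tightly good`, booked as `𝟙[η₁-good] − 𝟙[η₀-good]`) ⟹ the finite-range elastic inequality. [folklore] -/
theorem finiteRangeElastic_of_sitewise {η₀ η₁ R A eUp κE CE DE : ℝ}
    (h : ∀ (N : ℕ) (y : Fin N → E3), Function.Injective y → Sep y →
      ∃ τ : Fin N → Fin N → ℝ, ∀ i : Fin N,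
        eUp + κE * ((if GoodAt η₁ y i then (1 : ℝ) else 0) - (if GoodAt η₀ y i then (1 : ℝ) else 0))
            - CE * (if GoodAt η₀ y i then (1 : ℝ) else 0) - DE * (1 - (if GoodAt η₁ y i then (1 : ℝ) else 0)) ≤
          (∑ j, truncLJ R (dist (y i) (y j))) / 2 - A * densityProxy y i + (∑ j, τ j i - ∑ j, τ i j))
    (N : ℕ) (y : Fin N → E3) (hy : Function.Injective y) (hsep : Sep y) :
    eUp * N + κE * ((goodCount η₁ y : ℝ) - goodCount η₀ y) - CE * goodCount η₀ y - DE * ((N : ℝ) - goodCount η₁ y) ≤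
      interactionEnergy (truncLJ R) y - A * ∑ i, densityProxy y i := by
  obtain ⟨τ, hτ⟩ := h N y hy hsep
  have hs := sum_le_sum_of_transfers τ hτ
  simp only [Finset.sum_sub_distrib, Finset.sum_add_distrib, Finset.sum_const, Finset.card_univ, Fintype.card_fin, nsmul_eq_mul,
    ← Finset.mul_sum, ← Finset.sum_div] at hs
  rw [← goodCount_eq_sum, ← goodCount_eq_sum, ← two_mul_interactionEnergy_truncLJ] at hs
  linarith

/-- **`E′ ⟸ UP ∧ sitewise E′_R`** (tail floor discharged, `A = A_R`). [folklore chaining] -/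
theorem elasticPricing_of_sitewise_tf {η₀ η₁ R eUp κE CE DE : ℝ} (hR : 0 < R) (hU : PeriodicEnergyCeiling eUp) (hκ : 0 < κE)
    (h : ∀ (N : ℕ) (y : Fin N → E3), Function.Injective y → Sep y →
      ∃ τ : Fin N → Fin N → ℝ, ∀ i : Fin N,
        eUp + κE * ((if GoodAt η₁ y i then (1 : ℝ) else 0) - (if GoodAt η₀ y i then (1 : ℝ) else 0))
            - CE * (if GoodAt η₀ y i then (1 : ℝ) else 0) - DE * (1 - (if GoodAt η₁ y i then (1 : ℝ) else 0)) ≤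
          (∑ j, truncLJ R (dist (y i) (y j))) / 2 - (4 / 3 * (1 + 1 / (2 * R)) ^ 3 / R ^ 3) * densityProxy y i
            + (∑ j, τ j i - ∑ j, τ i j)) :
    ElasticPricing η₀ η₁ :=
  elasticPricing_of_rangeCut_tf hR hU hκ (finiteRangeElastic_of_sitewise h)

/-! ## §5. The crux BY NAME from sitewise certificates -/

/-- **Unsplit, sitewise**: `MuEquilibriumDoor ∧ UP(eUp) ∧ (eUp < e₁) ∧ sitewise-FRG_R (any `R > 0`, `A = A_R`) ⟹ AperiodicFrustratedLawGap`.
[folklore chaining] -/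
theorem aperiodicFrustratedLawGap_of_sitewise_frg {R eUp e₁ C : ℝ}
    (hDoor : Summit.AtomisticToContinuum.Crystallization.Theses.GrainCoreNetworkSplit.MuEquilibriumDoor)
    (hR : 0 < R) (hU : PeriodicEnergyCeiling eUp) (he : eUp < e₁)
    (h : ∀ (N : ℕ) (y : Fin N → E3), Function.Injective y → Sep y →
      ∃ τ : Fin N → Fin N → ℝ, ∀ i : Fin N,
        e₁ - C * (if GoodAt (1 / 20) y i then (1 : ℝ) else 0) ≤
          (∑ j, truncLJ R (dist (y i) (y j))) / 2 - (4 / 3 * (1 + 1 / (2 * R)) ^ 3 / R ^ 3) * densityProxy y i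
            + (∑ j, τ j i - ∑ j, τ i j)) :
    Summit.AtomisticToContinuum.Crystallization.Theses.FrustratedLawDichotomy.AperiodicFrustratedLawGap :=
  aperiodicFrustratedLawGap_of_rangeCut hDoor (tailFloor_holds hR) hU (finiteRangeFrustrationGap_of_sitewise h) he

/-- **Split, sitewise on the topological side**: `MuEquilibriumDoor ∧ E′(1/20,η₁) ∧ UP ∧ sitewise-T′_R ⟹ AperiodicFrustratedLawGap`
(`η₁ ≥ 1/20`, `κ_T > 0`, any `R > 0`, `A = A_R`). [folklore chaining] -/
theorem aperiodicFrustratedLawGap_of_sitewise_split {η₁ R eUp κT CT : ℝ} (h01 : (1 : ℝ) / 20 ≤ η₁)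
    (hDoor : Summit.AtomisticToContinuum.Crystallization.Theses.GrainCoreNetworkSplit.MuEquilibriumDoor)
    (hE : ElasticPricing (1 / 20) η₁) (hR : 0 < R) (hU : PeriodicEnergyCeiling eUp) (hκ : 0 < κT)
    (h : ∀ (N : ℕ) (y : Fin N → E3), Function.Injective y → Sep y →
      ∃ τ : Fin N → Fin N → ℝ, ∀ i : Fin N,
        eUp + κT * (1 - (if GoodAt η₁ y i then (1 : ℝ) else 0)) - CT * (if GoodAt (1 / 20) y i then (1 : ℝ) else 0) ≤
          (∑ j, truncLJ R (dist (y i) (y j))) / 2 - (4 / 3 * (1 + 1 / (2 * R)) ^ 3 / R ^ 3) * densityProxy y i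
            + (∑ j, τ j i - ∑ j, τ i j)) :
    Summit.AtomisticToContinuum.Crystallization.Theses.FrustratedLawDichotomy.AperiodicFrustratedLawGap :=
  aperiodicFrustratedLawGap_of_split_rangeCut h01 hDoor hE (tailFloor_holds hR) hU hκ (finiteRangeTopologicalPricing_of_sitewise h)

/-- **BOTH STRAIN CURRENCIES AT FINITE RANGE** (tail floor discharged twice): `MuEquilibriumDoor ∧ UP(eUp) ∧ E′_R ∧ T′_R ⟹ AperiodicFrustratedLawGap`
(`η₁ ≥ 1/20`, `κ_E, κ_T > 0`, any `R > 0`, `A = A_R`) — after this the energetic feed of column 27623 contains NO infinite-range statement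
and no `e⋆`. [folklore chaining] -/
theorem aperiodicFrustratedLawGap_of_rangeCut_both_tf {η₁ R eUp κE CE DE κT CT : ℝ} (h01 : (1 : ℝ) / 20 ≤ η₁)
    (hDoor : Summit.AtomisticToContinuum.Crystallization.Theses.GrainCoreNetworkSplit.MuEquilibriumDoor)
    (hR : 0 < R) (hU : PeriodicEnergyCeiling eUp) (hκE : 0 < κE) (hκT : 0 < κT)
    (hEl : ∀ (N : ℕ) (y : Fin N → E3), Function.Injective y → Sep y →
      eUp * N + κE * ((goodCount η₁ y : ℝ) - goodCount (1 / 20) y) - CE * goodCount (1 / 20) y - DE * ((N : ℝ) - goodCount η₁ y) ≤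
        interactionEnergy (truncLJ R) y - (4 / 3 * (1 + 1 / (2 * R)) ^ 3 / R ^ 3) * ∑ i, densityProxy y i)
    (hTop : FiniteRangeTopologicalPricing (1 / 20) η₁ R (4 / 3 * (1 + 1 / (2 * R)) ^ 3 / R ^ 3) eUp κT CT) :
    Summit.AtomisticToContinuum.Crystallization.Theses.FrustratedLawDichotomy.AperiodicFrustratedLawGap :=
  aperiodicFrustratedLawGap_of_split_rangeCut h01 hDoor (elasticPricing_of_rangeCut_tf hR hU hκE hEl) (tailFloor_holds hR) hU hκT hTop

end Summit.AtomisticToContinuum.Crystallization.Theorems.FrustratedLawDichotomyLocalPricing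

end
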